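import Literature.NumberTheory.EllipticCurves.IwasawaSelmerQuadraticLayerDecomposition
import Literature.NumberTheory.EllipticCurves.IwasawaSelmerDualFunctorialityProofs
import Literature.NumberTheory.EllipticCurves.KatoRankBoundAllPrimesSkeletonProofs
import HarnessLib

/-!
# The quadratic-layer decomposition on the Pontryagin duals: `X_F → X(E/K_∞) × X(E₂/K_∞)` is a
# `Λ`-quasi-isomorphism (kernel and cokernel killed by `4`); height-one lengths away from `2` ADD;
# torsion transfers (THEOREMS + one re-keying construction)

Greenberg, LNM 1716 (1999), §1 p. 60 (`X_E(F_∞) = Sel_E(F_∞)_p^∨` as a `Λ`-module), §4 p. 107; T. Dokchitser,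
V. Dokchitser, Ann. of Math. 172 (2010), Lemma 4.14 (`X_p(E/F) = X⁺ ⊕ X⁻`, `X⁻ = X_p(E_α/K)`). Sequel of
`IwasawaSelmerQuadraticLayerDecomposition` (Selmer side, inside `Γ_K`) and `IwasawaSelmerDualFunctorialityProofs`
(the `Λ`-linear dual of a `Γ`-equivariant map of Selmer groups).

Setting. `κ : ZpExtension K p`, `θ² = d ∈ K`, `c ∈ ker κ` with `cθ = −θ`, `γ ∈ Γ_K` FIXING `θ`, `E = W`, `E₂ = W₂` a
`K`-model of `W^{(d)}`, `D : W.SelmerDualData κ γ`, `D₂ : W₂.SelmerDualData κ γ`. The third dual is taken in ANY MODEL: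
a number field `F`, a curve `W_F/F`, `κ_F : ZpExtension F p`, `γ_F ∈ Γ_F`, `D_F : W_F.SelmerDualData κ_F γ_F`, together
with an identification of its Selmer group with the tree's subgroup model of `Sel(E/K_∞(θ))`,
`ΘS : Sel(W_F/F_{∞}) ≃+ W.selmerGroupOver p (kerStab κ θ)` carrying `conj_{γ_F}` to `conj_γ` (hypothesis `hΘS`; in the
application `F = K(θ)`, `W_F = W_F`, `κ_F = κ|_{Γ_F}` — the MODEL IDENTIFICATION, supplied separately).

* §1 generic `Λ`-module lemmas: a linear map whose kernel and cokernel are killed by `n ∉ 𝔮` preserves `ℓ_𝔮`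
  (`Module.lengthAt_eq_of_smul_ker_of_smul_range`) and torsion-ness (`Module.isTorsion_iff_of_smul_ker_of_smul_range`,
  `n` a non-zero-divisor); `Module.isTorsion_prod_iff`.
* §2 `SelmerDualData.rekey`: the SAME module is a dual datum for `γ·g`, `g ∈ ker κ` (inner automorphisms act trivially),
  so a generator can always be moved into `Stab(θ)` when `c ∈ ker κ` (`rekey_X`: definitional).
* §3 the two `Γ`-equivariant comparison maps `Φ₁ = ΘS⁻¹ ∘ res`, `Φ₂ = ΘS⁻¹ ∘ Ψ ∘ res` and their duals; **the
  quasi-isomorphism** `(Φ₁^∨, Φ₂^∨) : D_F.X →ₗ[Λ] D.X × D₂.X` (`quadraticLayerDualMap`) with kernel killed by `4`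
  (`four_smul_eq_zero_of_quadraticLayerDualMap_eq_zero`) and `4 • (D.X × D₂.X)` in its image
  (`exists_quadraticLayerDualMap_eq_four_smul`).
* §4 **`lengthAt_eq_add_of_quadraticLayer`**: `ℓ_𝔮(D_F.X) = ℓ_𝔮(D.X) + ℓ_𝔮(D₂.X)` at every prime `𝔮 ∌ 2` of `Λ`;
  **`isTorsion_iff_of_quadraticLayer`**: `D_F` torsion ⟺ `D` and `D₂` torsion.

Everything is proved; no named fact, no instance, no `sorry`. Motivation (cell `bsd-2adic`, seat `t42` GEN 23, crux
stmt-BirchSwinnertonDyer-22618): `K = ℚ`, `p = 2`, `θ = i`, `E′` split multiplicative at `2`, `E = E′^{(−1)}` additive: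
the decomposition reading `hdec` of T20 (a) (`Theorems/ByReductionTypeAtTwoAdditiveKatoTransportSymmetry`), modulo the
model identification `Sel((E′)_F/F_∞) ≅ Sel(E′/ℚ_∞(i))` (`F = ℚ(i)`). That specialisation is NOT made here.

## References

* [GreenbergLNM1716] R. Greenberg, LNM 1716 (1999), §1 (p. 60), §4 (p. 107).
* [DokchitserDokchitserAnnals2010] T. Dokchitser, V. Dokchitser, Ann. of Math. 172 (2010), Lemma 4.14.
* [BourbakiAC5to7] N. Bourbaki, *Algèbre commutative*, VII §4.4 (lengths at height-one primes).
-/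

noncomputable section

open scoped Classical

universe u v

namespace Literature.NumberTheory.EllipticCurves

/-! ## §1 Generic: quasi-isomorphisms preserve local lengths away from the defect, and torsion -/

namespace Module

section Quasi

variable {R : Type*} [CommRing R] {M N : Type*} [AddCommGroup M] [_root_.Module R M]
  [AddCommGroup N] [_root_.Module R N]

/-- **A linear map with kernel and cokernel killed by `n ∉ 𝔮` preserves `ℓ_𝔮`**: `ℓ_𝔮(M) = ℓ_𝔮(ker) + ℓ_𝔮(im)`,
`ℓ_𝔮(N) = ℓ_𝔮(im) + ℓ_𝔮(coker)`, and a module killed by a unit of `R_𝔮` has `ℓ_𝔮 = 0`. Bourbaki AC VII §4.4.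
[cite: BourbakiAC5to7, VII §4.4] -/
theorem lengthAt_eq_of_smul_ker_of_smul_range (f : M →ₗ[R] N) {n : R} (𝔮 : PrimeSpectrum R)
    (hn : n ∉ 𝔮.asIdeal) (hker : ∀ x, f x = 0 → n • x = 0) (hrange : ∀ y, ∃ x, f x = n • y) :
    lengthAt R M 𝔮 = lengthAt R N 𝔮 := by
  have hL1 : lengthAt R M 𝔮 = lengthAt R (LinearMap.ker f) 𝔮 + lengthAt R (M ⧸ LinearMap.ker f) 𝔮 :=
    lengthAt_eq_add_quotient _ 𝔮
  have hL2 : lengthAt R N 𝔮 = lengthAt R (LinearMap.range f) 𝔮 + lengthAt R (N ⧸ LinearMap.range f) 𝔮 :=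
    lengthAt_eq_add_quotient _ 𝔮
  have hk : ∀ x : LinearMap.ker f, n • x = 0 := fun x ↦ Subtype.ext (by
    rw [SetLike.val_smul, ZeroMemClass.coe_zero]; exact hker x x.2)
  have hc : ∀ y : N ⧸ LinearMap.range f, n • y = 0 := fun y ↦ by
    obtain ⟨y, rfl⟩ := Submodule.Quotient.mk_surjective _ y
    obtain ⟨x, hx⟩ := hrange y
    rw [← Submodule.Quotient.mk_smul, Submodule.Quotient.mk_eq_zero]
    exact ⟨x, hx⟩
  rw [lengthAt_eq_zero_of_smul_eq_zero (M := LinearMap.ker f) 𝔮 hn hk, zero_add,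
    lengthAt_eq_of_linearEquiv f.quotKerEquivRange 𝔮] at hL1
  rw [lengthAt_eq_zero_of_smul_eq_zero (M := N ⧸ LinearMap.range f) 𝔮 hn hc, add_zero] at hL2
  rw [hL1, hL2]

/-- **Torsion-ness passes along a linear map with kernel and cokernel killed by a non-zero-divisor `n`.**
[cite: BourbakiAC5to7, VII §4.4] -/
theorem isTorsion_iff_of_smul_ker_of_smul_range (f : M →ₗ[R] N) {n : R} (hn0 : n ∈ nonZeroDivisors R)
    (hker : ∀ x, f x = 0 → n • x = 0) (hrange : ∀ y, ∃ x, f x = n • y) :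
    _root_.Module.IsTorsion R M ↔ _root_.Module.IsTorsion R N := by
  constructor
  · intro hM y
    obtain ⟨x, hx⟩ := hrange y
    obtain ⟨⟨a, ha⟩, hax⟩ := @hM x
    refine ⟨⟨a * n, mul_mem ha hn0⟩, ?_⟩
    change (a * n) • y = 0
    rw [mul_smul, ← hx, ← map_smul, show a • x = 0 from hax, map_zero]
  · intro hN x
    obtain ⟨⟨a, ha⟩, hax⟩ := @hN (f x)
    refine ⟨⟨n * a, mul_mem hn0 ha⟩, ?_⟩
    change (n * a) • x = 0
    rw [mul_smul]
    exact hker _ (by rw [map_smul]; exact hax)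

variable {N' : Type*} [AddCommGroup N'] [_root_.Module R N']

/-- `M × N` is torsion iff both factors are. [cite: BourbakiAC5to7, VII §4.4] -/
theorem isTorsion_prod_iff :
    _root_.Module.IsTorsion R (N × N') ↔ _root_.Module.IsTorsion R N ∧ _root_.Module.IsTorsion R N' := by
  constructor
  · intro h
    refine ⟨fun y ↦ ?_, fun y' ↦ ?_⟩
    · obtain ⟨a, ha⟩ := @h (y, 0)
      exact ⟨a, (Prod.mk_eq_zero.mp ha).1⟩
    · obtain ⟨a, ha⟩ := @h (0, y')
      exact ⟨a, (Prod.mk_eq_zero.mp ha).2⟩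
  · rintro ⟨h, h'⟩ ⟨y, y'⟩
    obtain ⟨⟨a, ha⟩, hay⟩ := @h y
    obtain ⟨⟨b, hb⟩, hby⟩ := @h' y'
    refine ⟨⟨a * b, mul_mem ha hb⟩, Prod.ext ?_ ?_⟩
    · change (a * b) • y = 0
      rw [mul_comm, mul_smul, show a • y = 0 from hay, smul_zero]
    · change (a * b) • y' = 0
      rw [mul_smul, show b • y' = 0 from hby, smul_zero]

end Quasi

end Module

end Literature.NumberTheory.EllipticCurves

/-! ## §2 Re-keying a dual Selmer datum along `ker κ` -/

namespace WeierstrassCurve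

namespace SelmerDualData

open Literature.NumberTheory.EllipticCurves

variable {K : Type u} [Field K] [NumberField K] {p : ℕ} [Fact p.Prime] {W : WeierstrassCurve K}
  {κ : ZpExtension K p} {γ : Field.absoluteGaloisGroup K}

/-- **Re-keying along `ker κ`.** For `g ∈ ker κ = Gal(K̄/K_∞)`, `conj_g` is the identity on `H¹(K_∞, E[p^∞])` (inner
automorphisms), so a Pontryagin-dual datum for the generator `γ` IS one for `γ·g` — same module, same `Λ`-structure,
same character group. Used to move a generator into the stabiliser of `θ` (`γ ↦ γ·c`). Serre, *Local Fields* VII §5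
Prop. 3; Greenberg §1 p. 60. [cite: GreenbergLNM1716, §1 (p. 60)] -/
def rekey (D : W.SelmerDualData κ γ) {g : Field.absoluteGaloisGroup K} (hg : g ∈ κ.kerSubgroup) :
    W.SelmerDualData κ (γ * g) where
  X := D.X
  conj_mem s hs := W.map_conjH1_selmerGroupOver_le_holds p κ.kerSubgroup (γ * g) ⟨s, hs, rfl⟩
  toDual := D.toDual
  bijective := D.bijective
  toDual_T_smul x s := by
    have hconj : (⟨W.conjH1 p κ.kerSubgroup (γ * g) s,
        W.map_conjH1_selmerGroupOver_le_holds p κ.kerSubgroup (γ * g) ⟨s, s.2, rfl⟩⟩ : W.selmerInfty κ) =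
        ⟨W.conjH1 p κ.kerSubgroup γ s, D.conj_mem s s.2⟩ := by
      apply Subtype.ext
      change W.conjH1 p κ.kerSubgroup (γ * g) s = W.conjH1 p κ.kerSubgroup γ s
      rw [W.conjH1_mul_holds p κ.kerSubgroup γ g, AddMonoidHom.comp_apply, W.conjH1_of_mem_holds p κ.kerSubgroup hg,
        AddMonoidHom.id_apply]
    rw [hconj]
    exact D.toDual_T_smul x s
  toDual_C_smul := D.toDual_C_smul

/-- The re-keyed datum has the same module (definitional). [cite: GreenbergLNM1716, §1 (p. 60)] -/
theorem rekey_X (D : W.SelmerDualData κ γ) {g : Field.absoluteGaloisGroup K} (hg : g ∈ κ.kerSubgroup) :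
    (D.rekey hg).X = D.X :=
  rfl

end SelmerDualData

end WeierstrassCurve

/-! ## §3 The quasi-isomorphism of duals -/

namespace Literature.NumberTheory.EllipticCurves

namespace QuadraticLayer

open WeierstrassCurve SelmerDualData Module

section Dual

variable {K : Type u} [Field K] [NumberField K] {p : ℕ} [Fact p.Prime] (κ : ZpExtension K p)
  (W W₂ : WeierstrassCurve K) {d : K} (hd : d ≠ 0) {V : VariableChange K} (hV : V • W₂ = W.quadraticTwist d)
  {θ : AlgebraicClosure K} (hθ : θ ^ 2 = algebraMap K (AlgebraicClosure K) d)
  {c : Field.absoluteGaloisGroup K} (hcκ : c ∈ κ.kerSubgroup) (hcθ : c • θ = -θ)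
  {γ : Field.absoluteGaloisGroup K} (hγθ : γ • θ = θ)
  -- the model of `Sel(E/K_∞(θ))` carrying a dual datum
  {F : Type v} [Field F] [NumberField F] {WF : WeierstrassCurve F} {κF : ZpExtension F p}
  {γF : Field.absoluteGaloisGroup F} [(kerStab κ θ).Normal]
  (ΘS : WF.selmerInfty κF ≃+ W.selmerGroupOver p (kerStab κ θ))
  (hΘS : ∀ s, ((ΘS (WF.conjSelmerInfty κF γF s) : W.selmerGroupOver p (kerStab κ θ)) : W.subgroupH1 p (kerStab κ θ)) =
    W.conjH1 p (kerStab κ θ) γ (ΘS s : W.selmerGroupOver p (kerStab κ θ)))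
  (D : W.SelmerDualData κ γ) (D₂ : W₂.SelmerDualData κ γ) (DF : WF.SelmerDualData κF γF)

/-- `Φ₁ = ΘS⁻¹ ∘ res : Sel(E/K_∞) → Sel(W_F/F_∞)`. [cite: GreenbergLNM1716, §4 p. 107] -/
def resModel : W.selmerInfty κ →+ WF.selmerInfty κF :=
  (ΘS.symm : W.selmerGroupOver p (kerStab κ θ) →+ WF.selmerInfty κF).comp (resSel κ W (θ := θ))

/-- `Φ₂ = ΘS⁻¹ ∘ Ψ ∘ res : Sel(E₂/K_∞) → Sel(W_F/F_∞)`. [cite: GreenbergLNM1716, §4 p. 107] -/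
def twistResModel : W₂.selmerInfty κ →+ WF.selmerInfty κF :=
  (ΘS.symm : W.selmerGroupOver p (kerStab κ θ) →+ WF.selmerInfty κF).comp (twistResSel κ W W₂ hd hV hθ)

include hΘS in
/-- `ΘS⁻¹` carries `conj_γ` to `conj_{γ_F}`. [cite: GreenbergLNM1716, §1 (p. 60)] -/
private theorem symm_conj (t : W.selmerGroupOver p (kerStab κ θ))
    (t' : W.selmerGroupOver p (kerStab κ θ))
    (ht' : (t' : W.subgroupH1 p (kerStab κ θ)) = W.conjH1 p (kerStab κ θ) γ (t : W.subgroupH1 p (kerStab κ θ))) :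
    ΘS.symm t' = WF.conjSelmerInfty κF γF (ΘS.symm t) := by
  apply ΘS.injective
  rw [AddEquiv.apply_symm_apply]
  apply Subtype.ext
  rw [ht', hΘS, AddEquiv.apply_symm_apply]

include hΘS in
/-- `Φ₁ ∘ conj_γ = conj_{γ_F} ∘ Φ₁`. [cite: GreenbergLNM1716, §1 (p. 60)] -/
theorem resModel_conj (s : W.selmerInfty κ) :
    resModel κ W ΘS (W.conjSelmerInfty κ γ s) = WF.conjSelmerInfty κF γF (resModel κ W ΘS s) := by
  unfold resModel
  rw [AddMonoidHom.comp_apply, AddMonoidHom.comp_apply]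
  exact symm_conj κ W ΘS hΘS _ _ (coe_resSel_conj κ W γ s)

include hΘS hγθ in
/-- `Φ₂ ∘ conj_γ = conj_{γ_F} ∘ Φ₂` (`γ` fixes `θ`). [cite: GreenbergLNM1716, §4 p. 107] -/
theorem twistResModel_conj (s : W₂.selmerInfty κ) :
    twistResModel κ W W₂ hd hV hθ ΘS (W₂.conjSelmerInfty κ γ s) =
      WF.conjSelmerInfty κF γF (twistResModel κ W W₂ hd hV hθ ΘS s) := by
  unfold twistResModel
  rw [AddMonoidHom.comp_apply, AddMonoidHom.comp_apply]
  exact symm_conj κ W ΘS hΘS _ _ (coe_twistResSel_conj κ W W₂ hd hV hθ hγθ s)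

/-- **The comparison of duals `(Φ₁^∨, Φ₂^∨) : X_F → X(E/K_∞) × X(E₂/K_∞)`**, `Λ`-linear
(`SelmerDualData.dualMap` ×2). Greenberg §1 p. 60 / §4 p. 107; Dokchitser–Dokchitser Lemma 4.14 (`X⁺ ⊕ X⁻`).
[cite: GreenbergLNM1716, §4 p. 107] [cite: DokchitserDokchitserAnnals2010, Lemma 4.14] -/
def quadraticLayerDualMap : DF.X →ₗ[IwasawaAlgebra p] D.X × D₂.X :=
  (dualMap D DF (resModel κ W ΘS) (resModel_conj κ W ΘS hΘS)).prod
    (dualMap D₂ DF (twistResModel κ W W₂ hd hV hθ ΘS) (twistResModel_conj κ W W₂ hd hV hθ hγθ ΘS hΘS))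

/-- Components of `quadraticLayerDualMap`: `D.toDual ((Φ^∨ x).1) s = D_F.toDual x (Φ₁ s)`. [cite: GreenbergLNM1716, §1 (p. 60)] -/
theorem toDual_quadraticLayerDualMap_fst (x : DF.X) (s : W.selmerInfty κ) :
    D.toDual (quadraticLayerDualMap κ W W₂ hd hV hθ hγθ ΘS hΘS D D₂ DF x).1 s = DF.toDual x (resModel κ W ΘS s) :=
  toDual_dualMap D DF _ _ x s

/-- Components of `quadraticLayerDualMap`: `D₂.toDual ((Φ^∨ x).2) s' = D_F.toDual x (Φ₂ s')`. [cite: GreenbergLNM1716, §1 (p. 60)] -/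
theorem toDual_quadraticLayerDualMap_snd (x : DF.X) (s' : W₂.selmerInfty κ) :
    D₂.toDual (quadraticLayerDualMap κ W W₂ hd hV hθ hγθ ΘS hΘS D D₂ DF x).2 s' =
      DF.toDual x (twistResModel κ W W₂ hd hV hθ ΘS s') :=
  toDual_dualMap D₂ DF _ _ x s'

include hcκ hcθ in
/-- **The kernel of `(Φ₁^∨, Φ₂^∨)` is killed by `4`** (dual of «`4 · Sel(E/K_∞(θ)) ⊆ im`»).
[cite: DokchitserDokchitserAnnals2010, Lemma 4.14 (proof)] -/
theorem four_smul_eq_zero_of_quadraticLayerDualMap_eq_zero {x : DF.X}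
    (hx : quadraticLayerDualMap κ W W₂ hd hV hθ hγθ ΘS hΘS D D₂ DF x = 0) : (4 : ℕ) • x = 0 := by
  have h := Prod.mk_eq_zero.mp hx
  refine smul_eq_zero_of_dualMap_eq_zero₂ D DF (resModel κ W ΘS) (resModel_conj κ W ΘS hΘS) D₂
    (twistResModel κ W W₂ hd hV hθ ΘS) (twistResModel_conj κ W W₂ hd hV hθ hγθ ΘS hΘS) (fun t ↦ ?_) h.1 h.2
  obtain ⟨η, η', hηη'⟩ := exists_res_add_twistRes_eq_four_nsmul κ W W₂ hd hV hθ hcκ hcθ (ΘS t)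
  refine ⟨η, η', ?_⟩
  unfold resModel twistResModel
  rw [AddMonoidHom.comp_apply, AddMonoidHom.comp_apply, ← map_add]
  change ΘS.symm (resSel κ W η + twistResSel κ W W₂ hd hV hθ η') = 4 • t
  rw [hηη', map_nsmul, AddEquiv.symm_apply_apply]

include hcκ hcθ in
/-- **`4 • (X(E/K_∞) × X(E₂/K_∞))` lies in the image of `(Φ₁^∨, Φ₂^∨)`** (dual of «kernel killed by `4`»).
[cite: DokchitserDokchitserAnnals2010, Lemma 4.14 (proof)] -/
theorem exists_quadraticLayerDualMap_eq_four_smul (y : D.X × D₂.X) :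
    ∃ x : DF.X, quadraticLayerDualMap κ W W₂ hd hV hθ hγθ ΘS hΘS D D₂ DF x = (4 : ℕ) • y := by
  obtain ⟨x, h1, h2⟩ := exists_dualMap_pair_eq_smul D DF (resModel κ W ΘS) (resModel_conj κ W ΘS hΘS) D₂
    (twistResModel κ W W₂ hd hV hθ ΘS) (twistResModel_conj κ W W₂ hd hV hθ hγθ ΘS hΘS) (n := 4)
    (fun s s' hss' ↦ by
      apply four_nsmul_eq_zero_of_res_add_twistRes_eq_zero κ W W₂ hd hV hθ hcκ hcθ s s'
      apply ΘS.symm.injective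
      rw [map_add, map_zero]
      exact hss') y.1 y.2
  exact ⟨x, Prod.ext h1 h2⟩

/-! ## §4 Lengths add; torsion transfers -/

include hd hV hθ hcκ hcθ hγθ ΘS hΘS in
/-- **`ℓ_𝔮(X_F) = ℓ_𝔮(X(E/K_∞)) + ℓ_𝔮(X(E₂/K_∞))` at every prime `𝔮 ∌ 2` of `Λ = ℤ_p⟦T⟧`** (all primes if `p` is odd;
the primes not containing `2`, in particular every height-one prime other than `(2)`, if `p = 2`): the quasi-isomorphism
has `4`-torsion kernel and cokernel, invisible at `𝔮`, and local lengths are additive on products. This is the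
decomposition «`X_E(F_∞) ∼ X_E(ℚ_∞) ⊕ X_{E^{(d)}}(ℚ_∞)` up to modules killed by `2`» read prime by prime.
[cite: GreenbergLNM1716, §4 p. 107] [cite: DokchitserDokchitserAnnals2010, Lemma 4.14] [cite: BourbakiAC5to7, VII §4.4] -/
theorem lengthAt_eq_add_of_quadraticLayer (𝔮 : PrimeSpectrum (IwasawaAlgebra p)) (h2 : (2 : IwasawaAlgebra p) ∉ 𝔮.asIdeal) :
    lengthAt (IwasawaAlgebra p) DF.X 𝔮 = lengthAt (IwasawaAlgebra p) D.X 𝔮 + lengthAt (IwasawaAlgebra p) D₂.X 𝔮 := by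
  have h4 : ((4 : ℕ) : IwasawaAlgebra p) ∉ 𝔮.asIdeal := by
    intro h
    have : ((2 : IwasawaAlgebra p) * 2) ∈ 𝔮.asIdeal := by
      rw [show ((2 : IwasawaAlgebra p) * 2) = ((4 : ℕ) : IwasawaAlgebra p) by norm_num]; exact h
    rcases 𝔮.isPrime.mem_or_mem this with h' | h' <;> exact h2 h'
  rw [← lengthAt_prod]
  refine lengthAt_eq_of_smul_ker_of_smul_range (quadraticLayerDualMap κ W W₂ hd hV hθ hγθ ΘS hΘS D D₂ DF) 𝔮 h4
    (fun x hx ↦ ?_) (fun y ↦ ?_)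
  · rw [Nat.cast_smul_eq_nsmul]
    exact four_smul_eq_zero_of_quadraticLayerDualMap_eq_zero κ W W₂ hd hV hθ hcκ hcθ hγθ ΘS hΘS D D₂ DF hx
  · obtain ⟨x, hx⟩ := exists_quadraticLayerDualMap_eq_four_smul κ W W₂ hd hV hθ hcκ hcθ hγθ ΘS hΘS D D₂ DF y
    exact ⟨x, by rw [hx, Nat.cast_smul_eq_nsmul]⟩

include hd hV hθ hcκ hcθ hγθ ΘS hΘS in
/-- **`X_F` is `Λ`-torsion iff `X(E/K_∞)` and `X(E₂/K_∞)` are.** [cite: DokchitserDokchitserAnnals2010, Lemma 4.14] -/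
theorem isTorsion_iff_of_quadraticLayer : DF.IsTorsion ↔ D.IsTorsion ∧ D₂.IsTorsion := by
  have h4ne : ((4 : ℕ) : IwasawaAlgebra p) ≠ 0 := by
    intro h
    have h' := congrArg PowerSeries.constantCoeff h
    rw [map_natCast, map_zero] at h'
    exact (Nat.cast_ne_zero.mpr (by norm_num : (4 : ℕ) ≠ 0)) h'
  have h4 : ((4 : ℕ) : IwasawaAlgebra p) ∈ nonZeroDivisors (IwasawaAlgebra p) := mem_nonZeroDivisors_of_ne_zero h4ne
  unfold SelmerDualData.IsTorsion
  rw [← isTorsion_prod_iff]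
  refine isTorsion_iff_of_smul_ker_of_smul_range (quadraticLayerDualMap κ W W₂ hd hV hθ hγθ ΘS hΘS D D₂ DF) h4
    (fun x hx ↦ ?_) (fun y ↦ ?_)
  · rw [Nat.cast_smul_eq_nsmul]
    exact four_smul_eq_zero_of_quadraticLayerDualMap_eq_zero κ W W₂ hd hV hθ hcκ hcθ hγθ ΘS hΘS D D₂ DF hx
  · obtain ⟨x, hx⟩ := exists_quadraticLayerDualMap_eq_four_smul κ W W₂ hd hV hθ hcκ hcθ hγθ ΘS hΘS D D₂ DF y
    exact ⟨x, by rw [hx, Nat.cast_smul_eq_nsmul]⟩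

end Dual

end QuadraticLayer

end Literature.NumberTheory.EllipticCurves

end
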